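import Summits.QuantumFields.YangMills.Theorems.SmallFieldWideningLargeFieldMassRefinementTailOfHeightTail

/-!
# Route `SmallFieldWidening` — crux r3 `LargeFieldMassRefinementTail` (stmt-QuantumFields-22884): WHAT THE CRUX SAYS WITHOUT REFINEMENTS,
# WITHOUT THE COUPLING GATE, AND WHAT ANY PROOF OF IT MUST DELIVER (support file, leaf; width seat `ym-line-sfw-p2-w2`, line `birth` v3)

The crux is stated along the refined families `F.refine n` at the couplings `γL^{-n} ≤ γ₁`: one null sequence `δ n → 0` bounding, for
EVERY run `K`, the Gibbs mass of the complement of the all-heights small-field event.  THIS FILE is a kernel certificate of its logical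
position (no estimate is proved):

* §1 `largeFieldMassRefinementTail_iff_freeTopSteps` — **the crux contains no refinement**: by the level-shift identity of the
  companion file `…OfHeightTail` (run `K` of `F.refine n` at `γL^{-n}` IS run `K + n` of `F` at `γ`, thresholds shifted,
  `gibbsK_refine_real_compl_histGood`) it is EQUIVALENT to Bałaban's/King's UV-small-history statement for the UNREFINED family at the
  FIXED coupling: `Gibbs_{K+n}((histGood F θ (K + n) n)ᶜ) ≤ δ n` for all `n, K` — histories with `n` FREE TOP STEPS fail with probability
  `o(1)` in `n`, uniformly in the run ([Balaban1985UV3] (7) p.257; [King1986] Thm 3.4 (3.9)–(3.13) with a free top fraction instead).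
* §2 `largeFieldMassRefinementTail_iff_ungated` — **the coupling gate `γL^{-n} ≤ γ₁` is idle**: every Gibbs mass is `≤ 1` and the gate
  opens eventually (`L > 1`), so `δ` can be re-defined as `1` on the finitely many closed depths; the crux is EQUIVALENT to the same
  statement with NO `γ₁` at all (its content is `limsup_n sup_K mass = 0`, as the vetting refuter observed).
* §3 consequences any proof of the crux delivers, for EVERY family and EVERY coupling `γ > 0` (no smallness): `heightTail_tendsto_of_…` —
  an `o(1)` per-height large-field tail at EVERY height `j ≤ K` of every run, bare AND block-averaged,
  `Gibbs_K{¬PlaqSmall θ(K−j) (Ū^{j})} ≤ δ(K − j)`, `δ → 0` (the `o(1)` shadow of K2's estimate `T3CruxEstimates.HeightTailAt`, which asks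
  for a summable profile instead); and `historyTail_tendsto_of_…` — for every free top fraction `m`, `Gibbs_K((histGood K ⌊K/m⌋)ᶜ) ≤ δ(⌊K/m⌋)`
  (the `o(1)` shadow of K2's crux body `T3UnitScaleTilt.HistoryTailAt`, which asks for a summable `w_K`).  So r3 is not cheaper than the
  large-field improbability of the block-AVERAGED plaquettes at every height under the interacting law — the wall of crux K2
  (stmt-QuantumFields-18916 / 19936) in `o(1)` currency; conversely K2's per-height estimate gives r3 (`…OfHeightTail`).
* §4 `largeFieldMassRefinementTail_of_summableHeightTail` — the exact per-height currency: a SUMMABLE per-height profile `q` (the `htail`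
  clause of `HeightTailAt` with `Σ q < ∞`, but WITHOUT its summable-tails clause `Σ_n Σ'_t q(t+n) < ∞`) already gives r3; with §3 the crux is
  bracketed between the summable and the `o(1)` per-height large-field profiles of the block-averaged plaquettes.

WHAT THIS IS NOT: no large-field estimate, no claim on crux K2, nothing bearing on the Yang–Mills mass gap (record rung R3 only).

References: T. Bałaban, CMP 102 (1985) 255–275 [Balaban1985UV3] ((1)–(3) p.256, (7) p.257, (71) p.273); C. King, CMP 102 (1986) 649–677
[King1986] (Thm 3.4 (3.9)–(3.13)).
-/

noncomputable section

open MeasureTheory Filter Topology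
open Literature.MathematicalPhysics.QuantumFieldTheory.Balaban1983to89
open Literature.MathematicalPhysics.QuantumFieldTheory.Balaban1983to89.T3ContinuumYM3Torus
open Literature.MathematicalPhysics.QuantumFieldTheory.Balaban1983to89.T3UnitScaleTilt
open Literature.MathematicalPhysics.QuantumFieldTheory.Balaban1983to89.T3UnitLawDensityEML
open Summit.QuantumFields.YangMills.Theorems.LargeFieldMassRefinementTailOfHeightTail
  (θBal_mul_pow gibbsK_refine_real_compl_histGood)

namespace Summit.QuantumFields.YangMills.Theorems.LargeFieldMassRefinementTailFreeTopSteps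

/-! ## §1 The crux without refinements: UV-small histories with `n` free top steps, uniformly in the run -/

section FreeTopSteps

/-- **THE MASS IDENTITY AT BAŁABAN's THRESHOLDS**: the Gibbs mass (run `K` of `F.refine n` at `γL^{-n}`) of the complement of the
all-heights small-field event equals the Gibbs mass (run `K + n` of `F` at `γ`) of the complement of the UV-small-history event with `n`
free top steps — `θ_{γL^{-n}}(i) = θ_γ(i + n)` and `gibbsK_refine_real_compl_histGood`. [cite: Balaban1985UV3, (1)-(3) p.256 and (7) p.257] -/
theorem gibbsK_refine_real_compl_histGood_θBal (F : T3Family) {γ : ℝ} (hγ : 0 ≤ γ) (b₀ p₀ : ℝ) (n K : ℕ) :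
    (gibbsK (F.refine n) ℰp (γ * ((F.L : ℝ)⁻¹) ^ n) K).real
        (histGood (F.refine n) ℰp (θBal (F.refine n).L (γ * ((F.L : ℝ)⁻¹) ^ n) b₀ p₀) K 0)ᶜ =
      (gibbsK F ℰp γ (K + n)).real (histGood F ℰp (θBal F.L γ b₀ p₀) (K + n) n)ᶜ := by
  have hθ : θBal (F.refine n).L (γ * ((F.L : ℝ)⁻¹) ^ n) b₀ p₀ = fun i => θBal F.L γ b₀ p₀ (i + n) :=
    funext fun i => θBal_mul_pow F.L γ b₀ p₀ n i
  rw [hθ, gibbsK_refine_real_compl_histGood F ℰp measurableE_ℰp hγ (θBal F.L γ b₀ p₀) n K]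

/-- **r3 ⇔ KING's FREE-TOP-STEPS HISTORY TAIL FOR THE UNREFINED FAMILY** (same profile, same gate): `LargeFieldMassRefinementTail` holds iff
for every `L` there are `b₀ > 0`, `p₀ > 2`, `γ₁ > 0` such that every family with `F.L = L` and every `γ > 0` admit `δ n → 0` with
`Gibbs_{K+n}((histGood F θ_γ (K + n) n)ᶜ) ≤ δ n` for all `n, K` with `γL^{-n} ≤ γ₁` — the UV-small histories of run `K + n` with `n` free
top steps; the crux carries no refinement content. [cite: Balaban1985UV3, (7) p.257; King1986, Thm 3.4 (3.9) p.656] -/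
theorem largeFieldMassRefinementTail_iff_freeTopSteps :
    Summit.QuantumFields.YangMills.Theses.SmallFieldWidening.LargeFieldMassRefinementTail ↔
      ∀ L : ℕ, ∃ b₀ p₀ γ₁ : ℝ, 0 < b₀ ∧ 2 < p₀ ∧ 0 < γ₁ ∧
        ∀ (F : T3Family) (γ : ℝ), F.L = L → 0 < γ →
          ∃ δ : ℕ → ℝ, Tendsto δ atTop (𝓝 0) ∧
            ∀ n K : ℕ, γ * ((F.L : ℝ)⁻¹) ^ n ≤ γ₁ →
              (gibbsK F ℰp γ (K + n)).real (histGood F ℰp (θBal F.L γ b₀ p₀) (K + n) n)ᶜ ≤ δ n := by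
  unfold Summit.QuantumFields.YangMills.Theses.SmallFieldWidening.LargeFieldMassRefinementTail
  refine forall_congr' fun L => exists_congr fun b₀ => exists_congr fun p₀ => exists_congr fun γ₁ => ?_
  refine and_congr_right fun _ => and_congr_right fun _ => and_congr_right fun _ => ?_
  refine forall_congr' fun F => forall_congr' fun γ => forall_congr' fun _ => forall_congr' fun hγ => ?_
  refine exists_congr fun δ => and_congr_right fun _ => ?_
  refine forall_congr' fun n => forall_congr' fun K => forall_congr' fun _ => ?_
  rw [gibbsK_refine_real_compl_histGood_θBal F hγ.le b₀ p₀ n K]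

end FreeTopSteps

/-! ## §2 The coupling gate is idle -/

section Ungated

/-- Along `n → ∞` the refined couplings `γL^{-n}` enter every gate `γ₁ > 0` eventually (`L > 1`). [folklore] -/
theorem eventually_coupling_le (F : T3Family) (γ : ℝ) {γ₁ : ℝ} (hγ₁ : 0 < γ₁) :
    ∀ᶠ n : ℕ in atTop, γ * ((F.L : ℝ)⁻¹) ^ n ≤ γ₁ := by
  have hL' : (1 : ℝ) < F.L := by exact_mod_cast F.hL.2
  have hL0 : (0 : ℝ) < F.L := zero_lt_one.trans hL'
  have hT : Tendsto (fun n : ℕ => γ * ((F.L : ℝ)⁻¹) ^ n) atTop (𝓝 0) := by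
    simpa only [mul_zero] using
      (tendsto_pow_atTop_nhds_zero_of_lt_one (inv_nonneg.mpr hL0.le) (inv_lt_one_of_one_lt₀ hL')).const_mul γ
  exact hT.eventually (ge_mem_nhds hγ₁)

/-- **r3 ⇔ THE SAME STATEMENT WITH NO COUPLING GATE**: `LargeFieldMassRefinementTail` holds iff for every `L` there are `b₀ > 0`, `p₀ > 2`
such that every family with `F.L = L` and EVERY `γ > 0` admit `δ n → 0` with `Gibbs_{K+n}((histGood F θ_γ (K + n) n)ᶜ) ≤ δ n` for ALL
`n, K` — every mass is `≤ 1` and the gate opens eventually, so the finitely many closed depths cost nothing: the content of the crux is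
`lim_n sup_K mass = 0` at every coupling. [cite: Balaban1985UV3, (7) p.257; King1986, Thm 3.4 (3.9) p.656] -/
theorem largeFieldMassRefinementTail_iff_ungated :
    Summit.QuantumFields.YangMills.Theses.SmallFieldWidening.LargeFieldMassRefinementTail ↔
      ∀ L : ℕ, ∃ b₀ p₀ : ℝ, 0 < b₀ ∧ 2 < p₀ ∧
        ∀ (F : T3Family) (γ : ℝ), F.L = L → 0 < γ →
          ∃ δ : ℕ → ℝ, Tendsto δ atTop (𝓝 0) ∧
            ∀ n K : ℕ, (gibbsK F ℰp γ (K + n)).real (histGood F ℰp (θBal F.L γ b₀ p₀) (K + n) n)ᶜ ≤ δ n := by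
  rw [largeFieldMassRefinementTail_iff_freeTopSteps]
  constructor
  · intro h L
    obtain ⟨b₀, p₀, γ₁, hb₀, hp₀, hγ₁, H⟩ := h L
    refine ⟨b₀, p₀, hb₀, hp₀, fun F γ hFL hγ => ?_⟩
    obtain ⟨δ, hδ, hb⟩ := H F γ hFL hγ
    refine ⟨fun n => if γ * ((F.L : ℝ)⁻¹) ^ n ≤ γ₁ then δ n else 1, ?_, fun n K => ?_⟩
    · refine hδ.congr' ((eventually_coupling_le F γ hγ₁).mono fun n hn => ?_)
      beta_reduce
      rw [if_pos hn]
    · beta_reduce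
      split_ifs with hn
      · exact hb n K hn
      · haveI := isProbabilityMeasure_gibbsK F ℰp hγ.le (K + n)
        exact measureReal_le_one
  · intro h L
    obtain ⟨b₀, p₀, hb₀, hp₀, H⟩ := h L
    refine ⟨b₀, p₀, 1, hb₀, hp₀, one_pos, fun F γ hFL hγ => ?_⟩
    obtain ⟨δ, hδ, hb⟩ := H F γ hFL hγ
    exact ⟨δ, hδ, fun n K _ => hb n K⟩

end Ungated

/-! ## §3 What any proof of the crux delivers: `o(1)` large-field tails at every height and at every free top fraction -/

section Consequences

/-- The single-height large-field event at height `j` lies in the complement of the UV-small-history event of the same run with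
`K − j` free top steps (that event constrains exactly the heights `≤ j`). [cite: Balaban1985UV3, (7) p.257] -/
theorem not_plaqSmall_subset_compl_histGood (F : T3Family) (θ : ℕ → ℝ) {K j : ℕ} (hj : j ≤ K) :
    {U : GaugeField (F.P K) 0 (Matrix.specialUnitaryGroup (Fin 2) ℂ) |
        ¬ PlaqSmall (θ (K - j)) (Averaging.iter (fun i => BlockAveraging.blockAvg (P := F.P K) (j := i) ℰp) j U)} ⊆
      (histGood F ℰp θ K (K - j))ᶜ := by
  intro U hU hgood
  simp only [histGood, Set.mem_setOf_eq] at hU hgood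
  exact hU (hgood j (by omega))

/-- **r3 ⇒ `o(1)` PER-HEIGHT LARGE-FIELD TAILS AT EVERY HEIGHT, EVERY FAMILY, EVERY COUPLING**: if `LargeFieldMassRefinementTail` holds then
for every `L` there is a profile `b₀ > 0`, `p₀ > 2` such that every family with `F.L = L` and every `γ > 0` admit `δ → 0` with
`Gibbs_K{¬PlaqSmall θ(K−j) (Ū^{j})} ≤ δ(K − j)` for all runs `K` and ALL heights `j ≤ K` (bare `j = 0` and block-averaged `j ≥ 1`) — the
`o(1)` shadow of K2's estimate `HeightTailAt` (which asks for a summable profile in place of `δ`). [cite: Balaban1985UV3, (7) p.257 and (71) p.273] -/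
theorem heightTail_tendsto_of_largeFieldMassRefinementTail
    (h : Summit.QuantumFields.YangMills.Theses.SmallFieldWidening.LargeFieldMassRefinementTail) :
    ∀ L : ℕ, ∃ b₀ p₀ : ℝ, 0 < b₀ ∧ 2 < p₀ ∧
      ∀ (F : T3Family) (γ : ℝ), F.L = L → 0 < γ →
        ∃ δ : ℕ → ℝ, Tendsto δ atTop (𝓝 0) ∧
          ∀ K j : ℕ, j ≤ K → (gibbsK F ℰp γ K).real
            {U | ¬ PlaqSmall (θBal F.L γ b₀ p₀ (K - j))
              (Averaging.iter (fun i => BlockAveraging.blockAvg (P := F.P K) (j := i) ℰp) j U)} ≤ δ (K - j) := by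
  intro L
  obtain ⟨b₀, p₀, hb₀, hp₀, H⟩ := largeFieldMassRefinementTail_iff_ungated.mp h L
  refine ⟨b₀, p₀, hb₀, hp₀, fun F γ hFL hγ => ?_⟩
  obtain ⟨δ, hδ, hb⟩ := H F γ hFL hγ
  refine ⟨δ, hδ, fun K j hj => ?_⟩
  have hK : j + (K - j) = K := by omega
  have hmass := hb (K - j) j
  rw [hK] at hmass
  haveI := isProbabilityMeasure_gibbsK F ℰp hγ.le K
  exact (measureReal_mono (not_plaqSmall_subset_compl_histGood F (θBal F.L γ b₀ p₀) hj) (measure_ne_top _ _)).trans hmass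

/-- **r3 ⇒ `o(1)` HISTORY TAILS AT EVERY FREE TOP FRACTION**: if `LargeFieldMassRefinementTail` holds then for every `L` there is a profile
`b₀ > 0`, `p₀ > 2` such that every family with `F.L = L` and every `γ > 0` admit `δ → 0` with
`Gibbs_K((histGood F θ K ⌊K/m⌋)ᶜ) ≤ δ(⌊K/m⌋)` for every `m` and every run `K` — the `o(1)` shadow of K2's crux body `HistoryTailAt F γ b₀ p₀ m`
(stmt-QuantumFields-18916, which asks for a summable `w_K`), at a profile independent of `m`.
[cite: Balaban1985UV3, (7) p.257; King1986, Thm 3.4 (3.12) p.656] -/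
theorem historyTail_tendsto_of_largeFieldMassRefinementTail
    (h : Summit.QuantumFields.YangMills.Theses.SmallFieldWidening.LargeFieldMassRefinementTail) :
    ∀ L : ℕ, ∃ b₀ p₀ : ℝ, 0 < b₀ ∧ 2 < p₀ ∧
      ∀ (F : T3Family) (γ : ℝ), F.L = L → 0 < γ →
        ∃ δ : ℕ → ℝ, Tendsto δ atTop (𝓝 0) ∧
          ∀ m K : ℕ, (gibbsK F ℰp γ K).real (histGood F ℰp (θBal F.L γ b₀ p₀) K (K / m))ᶜ ≤ δ (K / m) := by
  intro L
  obtain ⟨b₀, p₀, hb₀, hp₀, H⟩ := largeFieldMassRefinementTail_iff_ungated.mp h L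
  refine ⟨b₀, p₀, hb₀, hp₀, fun F γ hFL hγ => ?_⟩
  obtain ⟨δ, hδ, hb⟩ := H F γ hFL hγ
  refine ⟨δ, hδ, fun m K => ?_⟩
  have hK : K - K / m + K / m = K := Nat.sub_add_cancel (Nat.div_le_self K m)
  have hmass := hb (K / m) (K - K / m)
  rw [hK] at hmass
  exact hmass

end Consequences

/-! ## §4 The exact per-height currency: a SUMMABLE per-height profile suffices (no summable tails), an `o(1)` one is necessary -/

section Sandwich

open Summit.QuantumFields.YangMills.Theorems.LargeFieldMassRefinementTailOfHeightTail
  (gibbsK_refine_real_compl_histGood_le_tsum refine_refine)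

/-- **r3 ⇐ A SUMMABLE PER-HEIGHT PROFILE, WITHOUT SUMMABLE TAILS**: if for every `L` there are `b₀ > 0`, `p₀ > 2`, `γ₁ > 0` such that
every family with `F.L = L` and every `0 < γ ≤ γ₁` admit a profile `q ≥ 0` with `Σ q < ∞` and
`Gibbs_K{¬PlaqSmall θ(K−j) (Ū^{j})} ≤ q(K − j)` for all `K`, `j ≤ K`, then `LargeFieldMassRefinementTail` holds — K2's estimate
`HeightTailAt` minus its summable-TAILS clause `Σ_n Σ'_t q(t + n) < ∞` (which King's telescoping needs and r3 does not: `δ n` is the tail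
`Σ'_t q(t + n − n₀)` of the least admissible refinement, and tails of a summable series tend to `0`).  With §3 this brackets the crux
between the summable and the `o(1)` per-height large-field profiles. [cite: Balaban1985UV3, (7) p.257 and (71) p.273; King1986, Thm 3.4 (3.13) p.656] -/
theorem largeFieldMassRefinementTail_of_summableHeightTail
    (h : ∀ L : ℕ, ∃ b₀ p₀ γ₁ : ℝ, 0 < b₀ ∧ 2 < p₀ ∧ 0 < γ₁ ∧
      ∀ (F : T3Family) (γ : ℝ), F.L = L → 0 < γ → γ ≤ γ₁ →
        ∃ q : ℕ → ℝ, (∀ i, 0 ≤ q i) ∧ Summable q ∧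
          ∀ K j : ℕ, j ≤ K → (gibbsK F ℰp γ K).real
            {U | ¬ PlaqSmall (θBal F.L γ b₀ p₀ (K - j))
              (Averaging.iter (fun i => BlockAveraging.blockAvg (P := F.P K) (j := i) ℰp) j U)} ≤ q (K - j)) :
    Summit.QuantumFields.YangMills.Theses.SmallFieldWidening.LargeFieldMassRefinementTail := by
  classical
  intro L
  obtain ⟨b₀, p₀, γ₁, hb₀, hp₀, hγ₁, H⟩ := h L
  refine ⟨b₀, p₀, γ₁, hb₀, hp₀, hγ₁, fun F γ hFL hγ => ?_⟩
  have hL0 : (0 : ℝ) < F.L := by exact_mod_cast (zero_lt_one.trans F.hL.2)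
  by_cases hex : ∃ n : ℕ, γ * ((F.L : ℝ)⁻¹) ^ n ≤ γ₁
  · have hn₀ : γ * ((F.L : ℝ)⁻¹) ^ Nat.find hex ≤ γ₁ := Nat.find_spec hex
    have hγ' : 0 < γ * ((F.L : ℝ)⁻¹) ^ Nat.find hex := mul_pos hγ (pow_pos (inv_pos.mpr hL0) _)
    obtain ⟨q, hq0, hq, htail⟩ := H (F.refine (Nat.find hex)) _ hFL hγ' hn₀
    refine ⟨fun n => ∑' t, q (t + (n - Nat.find hex)), ?_, fun n K hle => ?_⟩
    · exact (tendsto_sum_nat_add q).comp (tendsto_sub_atTop_nat (Nat.find hex))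
    · have hn : Nat.find hex ≤ n := Nat.find_min' hex hle
      obtain ⟨d, rfl⟩ : ∃ d, n = Nat.find hex + d := ⟨n - Nat.find hex, by omega⟩
      have hd : Nat.find hex + d - Nat.find hex = d := Nat.add_sub_cancel_left _ _
      have hc : γ * ((F.L : ℝ)⁻¹) ^ (Nat.find hex + d) =
          γ * ((F.L : ℝ)⁻¹) ^ Nat.find hex * ((F.L : ℝ)⁻¹) ^ d := by rw [pow_add, mul_assoc]
      beta_reduce
      rw [hd, hc, ← refine_refine F (Nat.find hex) d]
      exact gibbsK_refine_real_compl_histGood_le_tsum (F.refine (Nat.find hex)) hγ'.le b₀ p₀ hq0 hq htail d K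
  · exact ⟨fun _ => 0, tendsto_const_nhds, fun n K hle => (hex ⟨n, hle⟩).elim⟩

end Sandwich

end Summit.QuantumFields.YangMills.Theorems.LargeFieldMassRefinementTailFreeTopSteps

end
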